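import Summits.HodgeConjecture.HodgeConjecture.Theorems.Ring2WeilCoverageCMFieldCriteria
import HarnessLib

/-!
# Non-split Weil-type components over quartic CM fields, III: descent at a PRINCIPAL DEGREE-ONE prime of `F`
# (`π = t + σ`, `Nm π = ℓ` a prime SPLIT in `F`; the place `(π)` ramified or inert in `E/F`)

research route conditional on HC_CM; not a corollary; Q11.4-sentence-2 already refuted in dim ≥ 3.
Cell `pub-hodge-ring2`, seat `ring2-b03` (gen 48); kernel certificates for the Weil-type family-coverage census
`HOME/WEIL-FAMILY-COVERAGE.md` §b03.5 (operator priority5 2026-08-22T11:46:08Z). Companion of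
`Ring2WeilCoverageCMField{NormDescent, Criteria, InertPrimes, Ramified}` (gens 46–47), which decide a class
`[n] ∈ F^×/Nm_{E/F}(E^×)` (`F = ℚ[S]/(R)`, `E = ℚ[T]/(R(T²))`, `R = S² + pS + q`, Deligne's carriers
`Deligne1982/WeilTypeCMDiscriminant`) whenever its obstruction set `T(n)` contains a place over an odd prime `ℓ`
with ALL places of `F` over `ℓ` inert in `E/F`, or the Eisenstein prime. Those criteria are descents on the
divisibility of the four INTEGER coordinates by the rational prime `ℓ`; they cannot see an obstruction at ONE
of two conjugate places over a prime `ℓ` split in `F` — the situation of a NON-GALOIS CM field (census field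
`E = ℚ(√-(3+√2))`, `D₄`, class number 2: `14` of its `27` non-split classes `n ≤ 40` were left to computation).

This file supplies the missing `𝔭`-adic descent for a PRINCIPAL degree-one prime `𝔭 = (π)`, `π = t + σ ∈ ℤ[σ]`,
`Nm π = R(-t) = t² - pt + q = ℓ` prime:

* §1 the ENGINE (`normSq_eq_zero_of_dvd_step`): in integer coordinates `x = A + Bσ`, `y = C + Dσ` and with a
  multiplier `m = M₀ + M₁σ ∈ ℤ[σ]` (no longer a rational integer), the equation `x² - σy² = n·m²` is the pair
  `X = n(M₀² - qM₁²)`, `Y = n(2M₀M₁ - pM₁²)` (`X`, `Y` the coordinate forms of `NormDescent.normForm_coords`); if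
  every solution has `x, y, m ≡ 0 (mod π)` — i.e. `ℓ ∣ A - tB, C - tD, M₀ - tM₁` (`σ ≡ -t (mod π)`), hypothesis
  `hdiv` — then `x = πx₁`, `y = πy₁`, `m = πm₁` with `(x₁, y₁, m₁)` again a solution and `Nm m = ℓ · Nm m₁`
  (`Nm(M₀ + M₁σ) = M₀² - pM₀M₁ + qM₁²`), so descent on `|Nm m|` gives `Nm m = 0`; for a rational solution
  (`m ∈ ℤ_{>0}` after clearing denominators) this is absurd (`rat_no_solution_of_dvd_step`,
  `mk_ne_splitDiscriminantClassCM_of_dvd_step`). All substitutions are explicit polynomial identities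
  (`linear_combination`); no valuation theory is imported.
* §2 the generic certificate `mk_ne_splitDiscriminantClassCM_of_dvd_step`: `[n] ≠ [(-1)²] = [1]` in
  `F^×/Nm_{E/F}(E^×)` — the Weil-type component `(E, 4, [n])` has no `E`-Lagrangian member (Deligne Cor. 4.2).
  The three suppliers of `hdiv` (ramified `π = σ`: unit classes / classes `[ℓw]`; `π` inert in `E/F`: the
  «half-split» primes of a non-Galois `E`) are in the companion file `Ring2WeilCoverageCMFieldDegreeOneCriteria.lean`,
  the instances (the `14` residual classes of `ℚ(√-(3+√2))`) in `Ring2WeilCoverageCMFieldNonGalois.lean`.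

No named fact, no definition, no `sorry`; nothing about the Hodge conjecture is asserted.
References: [Deligne1982HodgeCycles] §4 p. 30 (1), Cor. 4.2, Lemma 4.6; [Landherr1936HermitianForms];
J. Neukirch, Algebraic Number Theory, V (3.4) (only valuation parity at one place is used, in elementary form). -/

noncomputable section

set_option linter.dupNamespace false

open Polynomial

namespace Summit.HodgeConjecture.HodgeConjecture.Ring2.WeilCoverageCM

open Literature.AlgebraicGeometry.Deligne1982
open Literature.AlgebraicGeometry.HodgeTheory (splitDiscriminantClassCM)

/-! ### §1 The engine: descent at `π = t + σ`, `Nm π = t² - pt + q = ℓ` -/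

section Engine

variable (p q t : ℤ) (ℓ : ℕ) [hℓ : Fact ℓ.Prime]

/-- **Descent at a principal degree-one prime `π = t + σ` of `ℤ[σ] = ℤ[S]/(S² + pS + q)`, `Nm π = ℓ`.**
In coordinates `x = A + Bσ`, `y = C + Dσ`, `m = M₀ + M₁σ`, the equation `x² - σy² = n·m²` reads
`X = n(M₀² - qM₁²)`, `Y = n(2M₀M₁ - pM₁²)`. If every solution is `≡ 0 (mod π)` in all three variables
(`hdiv`: `ℓ ∣ A - tB`, `ℓ ∣ C - tD`, `ℓ ∣ M₀ - tM₁`), then `Nm m = M₀² - pM₀M₁ + qM₁² = 0` for every solution: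
substitute `x = πx₁`, `y = πy₁`, `m = πm₁` (`x₁ = (B + a(t - p)) - aσ` for `A - tB = ℓa`, etc.), divide the
element equation by `π²` (the coordinate identities `ℓ²·X₁ = ((t-p)² - q)·X + q(2t-p)·Y`,
`ℓ²·Y₁ = (p-2t)·X + (t²-q)·Y` of multiplication by `π̄²`), and descend on `|Nm m| = ℓ·|Nm m₁|`. [folklore] -/
theorem normSq_eq_zero_of_dvd_step (hL : t ^ 2 - p * t + q = ℓ) (n : ℤ)
    (hdiv : ∀ A B C D M₀ M₁ : ℤ,
      A ^ 2 - q * B ^ 2 + 2 * q * C * D - p * q * D ^ 2 = n * (M₀ ^ 2 - q * M₁ ^ 2) →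
      2 * A * B - p * B ^ 2 - C ^ 2 + 2 * p * C * D - (p ^ 2 - q) * D ^ 2 = n * (2 * M₀ * M₁ - p * M₁ ^ 2) →
        (ℓ : ℤ) ∣ A - t * B ∧ (ℓ : ℤ) ∣ C - t * D ∧ (ℓ : ℤ) ∣ M₀ - t * M₁) :
    ∀ (k : ℕ) (A B C D M₀ M₁ : ℤ), (M₀ ^ 2 - p * M₀ * M₁ + q * M₁ ^ 2).natAbs ≤ k →
      A ^ 2 - q * B ^ 2 + 2 * q * C * D - p * q * D ^ 2 = n * (M₀ ^ 2 - q * M₁ ^ 2) →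
      2 * A * B - p * B ^ 2 - C ^ 2 + 2 * p * C * D - (p ^ 2 - q) * D ^ 2 = n * (2 * M₀ * M₁ - p * M₁ ^ 2) →
        M₀ ^ 2 - p * M₀ * M₁ + q * M₁ ^ 2 = 0 := by
  have hℓ0 : (ℓ : ℤ) ≠ 0 := by exact_mod_cast hℓ.out.ne_zero
  have hℓ2 : 2 ≤ ℓ := hℓ.out.two_le
  have hL0 : (t ^ 2 - p * t + q : ℤ) ≠ 0 := by rw [hL]; exact hℓ0
  intro k
  induction k with
  | zero => intro A B C D M₀ M₁ hk _ _; exact Int.natAbs_eq_zero.1 (Nat.eq_zero_of_le_zero hk)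
  | succ k ih =>
    intro A B C D M₀ M₁ hk hX hY
    obtain ⟨⟨a, ha⟩, ⟨c, hc⟩, ⟨μ, hμ⟩⟩ := hdiv A B C D M₀ M₁ hX hY
    have hA : A = t * B + (t ^ 2 - p * t + q) * a := by rw [hL]; linear_combination ha
    have hC : C = t * D + (t ^ 2 - p * t + q) * c := by rw [hL]; linear_combination hc
    have hM : M₀ = t * M₁ + (t ^ 2 - p * t + q) * μ := by rw [hL]; linear_combination hμ
    subst hA hC hM
    -- the new solution `x₁ = (B + a(t-p)) - aσ`, `y₁ = (D + c(t-p)) - cσ`, `m₁ = (M₁ + μ(t-p)) - μσ`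
    have hXn : (t ^ 2 - p * t + q) ^ 2 *
        ((B + a * (t - p)) ^ 2 - q * (-a) ^ 2 + 2 * q * (D + c * (t - p)) * (-c) - p * q * (-c) ^ 2
          - n * ((M₁ + μ * (t - p)) ^ 2 - q * (-μ) ^ 2)) = 0 := by
      linear_combination ((t - p) ^ 2 - q) * hX + q * (2 * t - p) * hY
    have hYn : (t ^ 2 - p * t + q) ^ 2 *
        (2 * (B + a * (t - p)) * (-a) - p * (-a) ^ 2 - (D + c * (t - p)) ^ 2
          + 2 * p * (D + c * (t - p)) * (-c) - (p ^ 2 - q) * (-c) ^ 2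
          - n * (2 * (M₁ + μ * (t - p)) * (-μ) - p * (-μ) ^ 2)) = 0 := by
      linear_combination (p - 2 * t) * hX + (t ^ 2 - q) * hY
    have h2 : (t ^ 2 - p * t + q : ℤ) ^ 2 ≠ 0 := pow_ne_zero 2 hL0
    have hX' : (B + a * (t - p)) ^ 2 - q * (-a) ^ 2 + 2 * q * (D + c * (t - p)) * (-c) - p * q * (-c) ^ 2
        = n * ((M₁ + μ * (t - p)) ^ 2 - q * (-μ) ^ 2) := by
      exact sub_eq_zero.1 ((mul_eq_zero.1 hXn).resolve_left h2)
    have hY' : 2 * (B + a * (t - p)) * (-a) - p * (-a) ^ 2 - (D + c * (t - p)) ^ 2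
        + 2 * p * (D + c * (t - p)) * (-c) - (p ^ 2 - q) * (-c) ^ 2
        = n * (2 * (M₁ + μ * (t - p)) * (-μ) - p * (-μ) ^ 2) := by
      exact sub_eq_zero.1 ((mul_eq_zero.1 hYn).resolve_left h2)
    -- the norm of the multiplier drops by the factor `ℓ`
    have hN : (t * M₁ + (t ^ 2 - p * t + q) * μ) ^ 2 - p * (t * M₁ + (t ^ 2 - p * t + q) * μ) * M₁ + q * M₁ ^ 2
        = (ℓ : ℤ) * ((M₁ + μ * (t - p)) ^ 2 - p * (M₁ + μ * (t - p)) * (-μ) + q * (-μ) ^ 2) := by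
      rw [← hL]; ring
    have hbound : ((M₁ + μ * (t - p)) ^ 2 - p * (M₁ + μ * (t - p)) * (-μ) + q * (-μ) ^ 2).natAbs ≤ k := by
      have e : ((ℓ : ℤ) * ((M₁ + μ * (t - p)) ^ 2 - p * (M₁ + μ * (t - p)) * (-μ) + q * (-μ) ^ 2)).natAbs
          = ℓ * ((M₁ + μ * (t - p)) ^ 2 - p * (M₁ + μ * (t - p)) * (-μ) + q * (-μ) ^ 2).natAbs := by
        rw [Int.natAbs_mul, Int.natAbs_natCast]
      rw [hN, e] at hk
      generalize ((M₁ + μ * (t - p)) ^ 2 - p * (M₁ + μ * (t - p)) * (-μ) + q * (-μ) ^ 2).natAbs = K at hk ⊢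
      have h2K : 2 * K ≤ k + 1 := le_trans (Nat.mul_le_mul_right K hℓ2) hk
      omega
    rw [hN, ih _ _ _ _ _ _ hbound hX' hY', mul_zero]

/-- **No rational solutions** of `X = n`, `Y = 0` (the norm form `a² - σb²` of `E/F` does not represent the
rational integer `n`) once the descent hypothesis `hdiv` of `normSq_eq_zero_of_dvd_step` holds: clear
denominators (`m ∈ ℤ_{>0}`, `Nm m = m² ≠ 0`). [folklore] -/
theorem rat_no_solution_of_dvd_step (hL : t ^ 2 - p * t + q = ℓ) (n : ℤ)
    (hdiv : ∀ A B C D M₀ M₁ : ℤ,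
      A ^ 2 - q * B ^ 2 + 2 * q * C * D - p * q * D ^ 2 = n * (M₀ ^ 2 - q * M₁ ^ 2) →
      2 * A * B - p * B ^ 2 - C ^ 2 + 2 * p * C * D - (p ^ 2 - q) * D ^ 2 = n * (2 * M₀ * M₁ - p * M₁ ^ 2) →
        (ℓ : ℤ) ∣ A - t * B ∧ (ℓ : ℤ) ∣ C - t * D ∧ (ℓ : ℤ) ∣ M₀ - t * M₁)
    (a₀ a₁ b₀ b₁ : ℚ)
    (hX : a₀ ^ 2 - q * a₁ ^ 2 + 2 * q * b₀ * b₁ - p * q * b₁ ^ 2 = n)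
    (hY : 2 * a₀ * a₁ - p * a₁ ^ 2 - b₀ ^ 2 + 2 * p * b₀ * b₁ - (p ^ 2 - q) * b₁ ^ 2 = 0) : False := by
  set m : ℕ := a₀.den * a₁.den * b₀.den * b₁.den with hm
  have hm0 : (m : ℤ) ≠ 0 := by
    have : 0 < m := by
      rw [hm]; exact Nat.mul_pos (Nat.mul_pos (Nat.mul_pos a₀.den_pos a₁.den_pos) b₀.den_pos) b₁.den_pos
    exact_mod_cast this.ne'
  have key : ∀ (r : ℚ) (k : ℕ), ((r.num * k : ℤ) : ℚ) = r * (r.den * k : ℕ) := by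
    intro r k
    push_cast
    rw [← mul_assoc, Rat.mul_den_eq_num]
  obtain ⟨A, hA⟩ : ∃ A : ℤ, (A : ℚ) = a₀ * m :=
    ⟨a₀.num * (a₁.den * b₀.den * b₁.den : ℕ), by rw [key, hm]; push_cast; ring⟩
  obtain ⟨B, hB⟩ : ∃ B : ℤ, (B : ℚ) = a₁ * m :=
    ⟨a₁.num * (a₀.den * b₀.den * b₁.den : ℕ), by rw [key, hm]; push_cast; ring⟩
  obtain ⟨Cc, hC⟩ : ∃ Cc : ℤ, (Cc : ℚ) = b₀ * m :=
    ⟨b₀.num * (a₀.den * a₁.den * b₁.den : ℕ), by rw [key, hm]; push_cast; ring⟩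
  obtain ⟨D, hD⟩ : ∃ D : ℤ, (D : ℚ) = b₁ * m :=
    ⟨b₁.num * (a₀.den * a₁.den * b₀.den : ℕ), by rw [key, hm]; push_cast; ring⟩
  have hXZ : A ^ 2 - q * B ^ 2 + 2 * q * Cc * D - p * q * D ^ 2 = n * ((m : ℤ) ^ 2 - q * 0 ^ 2) := by
    have h : (A : ℚ) ^ 2 - q * (B : ℚ) ^ 2 + 2 * q * (Cc : ℚ) * D - p * q * (D : ℚ) ^ 2 =
        n * (((m : ℤ) : ℚ) ^ 2 - q * 0 ^ 2) := by
      rw [hA, hB, hC, hD]; push_cast; linear_combination ((m : ℚ)) ^ 2 * hX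
    exact_mod_cast h
  have hYZ : 2 * A * B - p * B ^ 2 - Cc ^ 2 + 2 * p * Cc * D - (p ^ 2 - q) * D ^ 2
      = n * (2 * (m : ℤ) * 0 - p * 0 ^ 2) := by
    have h : 2 * (A : ℚ) * B - p * (B : ℚ) ^ 2 - (Cc : ℚ) ^ 2 + 2 * p * (Cc : ℚ) * D
        - (p ^ 2 - q) * (D : ℚ) ^ 2 = n * (2 * ((m : ℤ) : ℚ) * 0 - p * 0 ^ 2) := by
      rw [hA, hB, hC, hD]; linear_combination ((m : ℚ)) ^ 2 * hY
    exact_mod_cast h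
  have h := normSq_eq_zero_of_dvd_step p q t ℓ hL n hdiv _ A B Cc D m 0 le_rfl hXZ hYZ
  have : (m : ℤ) ^ 2 = 0 := by linear_combination h
  exact hm0 (pow_eq_zero_iff (n := 2) (by norm_num) |>.1 this)

end Engine

/-! ### §2 The generic certificate on Deligne's carriers -/

/-- **Non-split criterion from a degree-one descent (generic).** For `R = S² + pS + q` with both carrier
polynomials irreducible (instance arguments), `π = t + σ` with `Nm π = t² - pt + q = ℓ` prime, and a rational
integer `n` for which every solution of `x² - σy² = n·m²` in `ℤ[σ]` is `≡ 0 (mod π)` (`hdiv`): the class of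
`n` in `F^×/Nm_{E/F}(E^×)` is not the split class `[(-1)²]` of `E`-rank `4` — the Weil-type component
`(E, d = 4, δ = [n])` has no `E`-Lagrangian member. [cite: Deligne1982HodgeCycles, §4 p. 30 (1) and Cor. 4.2]
[cite: Landherr1936HermitianForms] -/
theorem mk_ne_splitDiscriminantClassCM_of_dvd_step {p q : ℤ} {R : Polynomial ℤ}
    (hR : R = X ^ 2 + C p * X + C q) [Fact (Irreducible (realPolyQ R))] [Fact (Irreducible (cmPolyQ R))]
    (t : ℤ) (ℓ : ℕ) [Fact ℓ.Prime] (hL : t ^ 2 - p * t + q = ℓ) (n : ℤ)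
    (hdiv : ∀ A B C D M₀ M₁ : ℤ,
      A ^ 2 - q * B ^ 2 + 2 * q * C * D - p * q * D ^ 2 = n * (M₀ ^ 2 - q * M₁ ^ 2) →
      2 * A * B - p * B ^ 2 - C ^ 2 + 2 * p * C * D - (p ^ 2 - q) * D ^ 2 = n * (2 * M₀ * M₁ - p * M₁ ^ 2) →
        (ℓ : ℤ) ∣ A - t * B ∧ (ℓ : ℤ) ∣ C - t * D ∧ (ℓ : ℤ) ∣ M₀ - t * M₁)
    (u : (realField R)ˣ) (hu : (u : realField R) = AdjoinRoot.of (realPolyQ R) n) :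
    (QuotientGroup.mk u : cmNormResidueGroup R) ≠ splitDiscriminantClassCM R 2 := by
  intro h
  rw [splitDiscriminantClassCM, neg_one_sq] at h
  obtain ⟨z, -, hz⟩ := exists_eq_ratCast_mul_norm_of_mk_eq (q := u) (u := 1) (c := 1)
    (by rw [Units.val_one, Rat.cast_one]) h
  rw [Rat.cast_one, one_mul] at hz
  obtain ⟨a, b, rfl⟩ := exists_eq_realToCM_add_mul_cmRoot R z
  rw [norm_coords, algebraMap_realField_eq, hu] at hz
  have hF := (realToCM R).injective hz
  obtain ⟨a₀, a₁, rfl⟩ := exists_coords_quadratic hR a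
  obtain ⟨b₀, b₁, rfl⟩ := exists_coords_quadratic hR b
  rw [normForm_coords hR] at hF
  have key : AdjoinRoot.of (realPolyQ R) (a₀ ^ 2 - q * a₁ ^ 2 + 2 * q * b₀ * b₁ - p * q * b₁ ^ 2 - n) +
      AdjoinRoot.of (realPolyQ R) (2 * a₀ * a₁ - p * a₁ ^ 2 - b₀ ^ 2 + 2 * p * b₀ * b₁ - (p ^ 2 - q) * b₁ ^ 2) *
        AdjoinRoot.root (realPolyQ R) = 0 := by
    rw [map_sub, sub_add_eq_add_sub, sub_eq_zero]
    exact hF.symm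
  obtain ⟨hX, hY⟩ := coords_eq_zero_quadratic hR key
  exact rat_no_solution_of_dvd_step p q t ℓ hL n hdiv a₀ a₁ b₀ b₁ (by linarith) hY

end Summit.HodgeConjecture.HodgeConjecture.Ring2.WeilCoverageCM

end
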